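import Summits.ResolutionOfSingularities.ResolutionOfSingularities.Theorems.WeightedInvariantHypersurfaceCentreAssemblyPlusStalkGameSide
import HarnessLib

/-!
# K4-E with STALK-MAP COMPATIBILITY — the game-side model of the local rings of `B₊`, compatible with `σ₊`

Route `ResolutionOfSingularities/WeightedInvariant`, crux `Theses.WeightedInvariant.HypersurfaceCentreConstruction`
(stmt-ResolutionOfSingularities-19897), door line `local-engine`, E2 tier; registrar SPEC (Δ8) of res-L1-w43-plan-1
(`HOME/L/res-L1-w43-plan-1/Compat_sketch.lean` 1041408e15236dc9, OFFER (o59-a), first file; serves (S-b2) too).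

The K4-E point model `exists_gameSide_stalk_model` (`…CentreAssemblyPlusStalkGameSide`, res-type-089 + res-type-048's package)
gives, at a point `y'` of `B₊ = R'.plus` over an affine `U = Spec A`, a prime `𝔫'` of the game-side carrier
`extReesAlgebra I'` (`I'ₙ = 𝒥ₙ(U) A'`, `A' = A_{𝔮_y}` the dictionary model of `𝒪_{Y,y}`, `y = σ₊ y'`) and a ring isomorphism
`Ψ : 𝒪_{B₊, y'} ≃+* (extReesAlgebra I')_{𝔫'}` transporting strict transforms to `t⁻¹`-saturations.  The interface
`Stage.SuccOverCentreAt` / `Stage.SuccOffCentreAt` (…ELadderTwoCompatible) needs ONE MORE conjunct: `Ψ` commutes with the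
structure maps, `Ψ (σ₊^♯_{y'} (a_y)) = a / 1` for every section `a ∈ Γ(Y, U)` (germ-level compatibility; stalk-level
compatibility follows by the universal property of `𝒪_{Y,y} = A_{𝔮_y}`).  This file RE-THREADS the K4-E chain
`Ψ = E₁ ≫ E₂⁻¹ ≫ E₃ ≫ g` (stalk map of the chart `φ_U`, stalk map of the inclusion of the vertex complement, `𝒪_{Spec S, q} ≅ S_q`,
res-type-048's `g : S_q ≃ (extReesAlgebra I')_{𝔫'}` whose `hgbase` clause IS the compatibility on the algebra side) and records
the compatibility of each link:
* generic: `stalkMap_germ_congr`, `stalkMap_comp_apply`, `fromSpec_stalkMap_germ` (germs along `hU.fromSpec` are `toStalk`),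
  `exists_stalk_ringEquiv_localization_Spec_compat` (K4-B model `𝒪_{Spec S,q} ≃ S_q` with `toStalk s ↦ s/1`);
* chart: `exists_stalk_ringEquiv_plusChartι_compat`, `exists_stalk_ringEquiv_of_plusChartFac_compat` (K4-E (I) + compatibility);
* **`exists_gameSide_stalk_model_of_plusChartFac_compat`**, **`exists_gameSide_stalk_model_compat`** (= K4-E VERBATIM + the conjunct),
  and **`gameSideStalkModelCompat`** — the registrar's `GameSideStalkModelCompat` statement, binder for binder.
Engineering note (as in K4-E): every step touching local rings of the glued `B₊` is an application of a lemma over variable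
schemes/rings; element-level compatibilities are moved along `Scheme.Hom.germ_stalkMap`, never by `rw` inside those carriers.
Def-free; OURS bookkeeping; no claim about Hironaka's problem; AI-written, weaker than expert review.
[cite: Wlodarczyk2022, Def. 5.1.1; 3.3.12]
-/

noncomputable section

set_option linter.dupNamespace false -- mandated namespace of this single-conjunct summit

open CategoryTheory AlgebraicGeometry TopologicalSpace IsLocalRing
open scoped LaurentPolynomial
open LaurentPolynomial
open Literature.AlgebraicGeometry.Resolution
open Summit.ResolutionOfSingularities.ResolutionOfSingularities.Theorems

namespace Summit.ResolutionOfSingularities.ResolutionOfSingularities.Cruxes.HypersurfaceCentreConstruction.LocalEngine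

universe u

/-! ## Generic: germs along stalk maps -/

section Generic

/-- Germs pushed along the stalk maps of two EQUAL morphisms agree (the stalk maps live over propositionally equal
points, so this is the dependent form of `congrArg`). [folklore] -/
theorem stalkMap_germ_congr {X Y : Scheme.{u}} {f g : X ⟶ Y} (e : f = g) (U : Y.Opens) (x : X)
    (hf : f x ∈ U) (hg : g x ∈ U) (a : Γ(Y, U)) :
    f.stalkMap x (Y.presheaf.germ U (f x) hf a) = g.stalkMap x (Y.presheaf.germ U (g x) hg a) := by
  subst e; rfl

/-- `(f ≫ g)^♯_x = f^♯_x ∘ g^♯_{f x}` on elements (`Scheme.Hom.stalkMap_comp`). [folklore] -/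
theorem stalkMap_comp_apply {X Y Z : Scheme.{u}} (f : X ⟶ Y) (g : Y ⟶ Z) (x : X)
    (z : Z.presheaf.stalk ((f ≫ g) x)) :
    (f ≫ g).stalkMap x z = f.stalkMap x (g.stalkMap (f x) z) := by
  rw [Scheme.Hom.stalkMap_comp]
  rfl

/-- `(f ≫ g)^♯_x` on a germ, as `f^♯_x ∘ g^♯_{f x}` on the same germ read at `g (f x)` (the two points agree definitionally;
stated with both membership witnesses so that no unfolding happens at the use site). [folklore] -/
theorem stalkMap_comp_germ {X Y Z : Scheme.{u}} (f : X ⟶ Y) (g : Y ⟶ Z) (x : X) (U : Z.Opens)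
    (h : (f ≫ g) x ∈ U) (h' : g (f x) ∈ U) (a : Γ(Z, U)) :
    (f ≫ g).stalkMap x (Z.presheaf.germ U ((f ≫ g) x) h a) =
      f.stalkMap x (g.stalkMap (f x) (Z.presheaf.germ U (g (f x)) h' a)) := by
  rw [stalkMap_comp_apply]
  rfl

/-- **Germs along `hU.fromSpec : Spec Γ(X, U) ⟶ X` are `toStalk`**: the stalk map of `fromSpec` at `p` sends the germ of a
section `a ∈ Γ(X, U)` to `toStalk Γ(X, U) p a` (`fromSpec_app_self` + `germ_res`). [folklore] -/
theorem fromSpec_stalkMap_germ {X : Scheme.{u}} {U : X.Opens} (hU : IsAffineOpen U)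
    (p : Spec Γ(X, U)) (h : hU.fromSpec p ∈ U) (a : Γ(X, U)) :
    hU.fromSpec.stalkMap p (X.presheaf.germ U (hU.fromSpec p) h a) = StructureSheaf.toStalk Γ(X, U) p a := by
  rw [Scheme.Hom.germ_stalkMap_apply, IsAffineOpen.fromSpec_app_self]
  simp only [CommRingCat.hom_comp, RingHom.coe_comp, Function.comp_apply]
  erw [TopCat.Presheaf.germ_res_apply']
  exact StructureSheaf.algebraMap_germ_apply (R := Γ(X, U)) ⊤ p trivial a

/-- `Spec` maps act on `toStalk` by the ring map (`stalkMap_toStalk`, `Scheme`-level spelling). [folklore] -/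
theorem specMap_stalkMap_toStalk {R S : CommRingCat.{u}} (h : R ⟶ S) (q : Spec S) (r : R) :
    (Spec.map h).stalkMap q (StructureSheaf.toStalk R ((Spec.map h) q) r) = StructureSheaf.toStalk S q (h r) :=
  AlgebraicGeometry.stalkMap_toStalk_apply h q r

/-- **K4-B with the localisation model AND its compatibility**: on `Spec S`, a ring isomorphism `𝒪_{Spec S, q} ≃+* S_q`
carrying the stalk of the ideal sheaf of every ideal `I ≤ S` onto `I S_q` and `toStalk S q s` to `s / 1`
(`IsLocalization.algEquiv`; the point is taken in `PrimeSpectrum S` so that `S_q` carries the plain instances of `S`). [folklore] -/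
theorem exists_stalk_ringEquiv_localization_Spec_compat {S : Type} [CommRing S] (q : PrimeSpectrum S) :
    ∃ E : (Spec (CommRingCat.of S)).presheaf.stalk q ≃+* Localization.AtPrime q.asIdeal,
      (∀ I : Ideal S, (stalkIdeal (Scheme.IdealSheafData.ofIdealTop
          (I.map (Scheme.ΓSpecIso (CommRingCat.of S)).inv.hom)) q).map
          (E : (Spec (CommRingCat.of S)).presheaf.stalk q →+* Localization.AtPrime q.asIdeal) =
        I.map (algebraMap S (Localization.AtPrime q.asIdeal))) ∧
      ∀ s : S, E (StructureSheaf.toStalk S q s) = algebraMap S (Localization.AtPrime q.asIdeal) s := by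
  let E : (Spec.structureSheaf S).presheaf.stalk q ≃+* Localization.AtPrime q.asIdeal :=
    (IsLocalization.algEquiv q.asIdeal.primeCompl ((Spec.structureSheaf S).presheaf.stalk q)
      (Localization.AtPrime q.asIdeal)).toRingEquiv
  have hEs : ∀ s : S, E (StructureSheaf.toStalk S q s) = algebraMap S (Localization.AtPrime q.asIdeal) s :=
    fun s => (IsLocalization.algEquiv q.asIdeal.primeCompl ((Spec.structureSheaf S).presheaf.stalk q)
      (Localization.AtPrime q.asIdeal)).commutes s
  have hE : (E : (Spec.structureSheaf S).presheaf.stalk q →+* Localization.AtPrime q.asIdeal).comp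
      (StructureSheaf.toStalk S q).hom = algebraMap S (Localization.AtPrime q.asIdeal) :=
    RingHom.ext fun s => hEs s
  refine ⟨E, fun I => ?_, hEs⟩
  rw [stalkIdeal_ofIdealTop_eq_map]
  erw [Ideal.map_map, hE]

end Generic

/-! ## The chart `φ_U`: K4-E (I) with compatibility -/

section Chart

variable {Y : Scheme.{0}} (R' : ReesFiltration Y) (U : Y.affineOpens)

set_option maxHeartbeats 400000 in
/-- K4-A backwards along the inclusion of the vertex complement, WITH COMPATIBILITY: an isomorphism
`𝒪_{Spec S, q} ≅ 𝒪_{chart, x}` carrying `L_q` to `(L|_{chart})_x` and `toStalk S q s` to the germ of `s` at `x` pushed along the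
inclusion (it IS the stalk map of the inclusion, read at the point `q` of `PrimeSpectrum S` under `x`). [folklore] -/
theorem exists_stalk_ringEquiv_plusChartι_compat (x : (R'.plusChart U : Scheme.{0}))
    (q : PrimeSpectrum (R'.sectionsRing U)) (hq : (R'.plusChart U).ι x = q) :
    ∃ E₂ : (Spec (CommRingCat.of (R'.sectionsRing U))).presheaf.stalk q ≃+*
        (R'.plusChart U : Scheme.{0}).presheaf.stalk x,
      (∀ L : (Spec (CommRingCat.of (R'.sectionsRing U))).IdealSheafData,
        (stalkIdeal (L.comap (R'.plusChart U).ι) x).map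
          (E₂.symm : (R'.plusChart U : Scheme.{0}).presheaf.stalk x →+*
            (Spec (CommRingCat.of (R'.sectionsRing U))).presheaf.stalk q) = stalkIdeal L q) ∧
      ∀ s : R'.sectionsRing U, E₂ (StructureSheaf.toStalk (R'.sectionsRing U) q s) =
        (R'.plusChart U).ι.stalkMap x (StructureSheaf.toStalk (R'.sectionsRing U) ((R'.plusChart U).ι x) s) := by
  subst hq
  refine ⟨(asIso ((R'.plusChart U).ι.stalkMap x)).commRingCatIsoToRingEquiv, fun L => ?_, fun s => rfl⟩
  rw [stalkIdeal_comap_eq_map_ringEquiv (R'.plusChart U).ι L x]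
  exact Ideal.map_of_equiv _

variable (φ : (R'.plusChart U : Scheme.{0}) ⟶ (R'.plus : Scheme.{0}))
  (hφ : φ ≫ R'.plus.ι = (R'.plusChart U).ι ≫ R'.openCover.f ⟨U.1, U.2⟩)

include hφ

/-- **The structure maps through the chart**: for a section `a ∈ Γ(Y, U)` and a point `x` of the chart's vertex complement,
the germ of `a` at `y = σ₊(φ_U x)` pushed along `σ₊` and then along the chart `φ_U` is the germ, pushed along the inclusion of
the vertex complement, of `toStalk S (ι x) (a · 1)` — because `φ_U ≫ σ₊ = ι ≫ Spec (A → S) ≫ fromSpec`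
(`plusChartFac_comp_πPlus`), germs along `fromSpec` are `toStalk` and `Spec` maps act on `toStalk` by the ring map. [folklore] -/
theorem stalkMap_plusChartFac_stalkMap_πPlus_germ (x : (R'.plusChart U : Scheme.{0}))
    (hy : R'.πPlus (φ x) ∈ (U : Y.Opens)) (a : Γ(Y, U)) :
    φ.stalkMap x ((R'.πPlus.stalkMap (φ x)) ((Y.presheaf.germ (U : Y.Opens) (R'.πPlus (φ x)) hy) a)) =
      (R'.plusChart U).ι.stalkMap x (StructureSheaf.toStalk (R'.sectionsRing U) ((R'.plusChart U).ι x)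
        (algebraMap Γ(Y, U) (R'.sectionsRing U) a)) := by
  have hψ := plusChartFac_comp_πPlus R' U φ hφ
  have hy1 : ((R'.plusChart U).ι ≫ Spec.map (CommRingCat.ofHom (algebraMap Γ(Y, U) (R'.sectionsRing U))) ≫
      U.2.fromSpec) x ∈ (U : Y.Opens) := hψ ▸ hy
  have hy2 : (Spec.map (CommRingCat.ofHom (algebraMap Γ(Y, U) (R'.sectionsRing U))) ≫ U.2.fromSpec)
      ((R'.plusChart U).ι x) ∈ (U : Y.Opens) := by
    rw [← Scheme.Hom.comp_apply]; exact hy1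
  have hy3 : U.2.fromSpec ((Spec.map (CommRingCat.ofHom (algebraMap Γ(Y, U) (R'.sectionsRing U))))
      ((R'.plusChart U).ι x)) ∈ (U : Y.Opens) := by
    rw [← Scheme.Hom.comp_apply]; exact hy2
  have h1 : φ.stalkMap x ((R'.πPlus.stalkMap (φ x)) ((Y.presheaf.germ (U : Y.Opens) (R'.πPlus (φ x)) hy) a)) =
      (φ ≫ R'.πPlus).stalkMap x ((Y.presheaf.germ (U : Y.Opens) ((φ ≫ R'.πPlus) x) hy) a) :=
    (stalkMap_comp_apply φ R'.πPlus x _).symm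
  rw [h1, stalkMap_germ_congr hψ (U : Y.Opens) x hy hy1 a,
    stalkMap_comp_germ (R'.plusChart U).ι _ x (U : Y.Opens) hy1 hy2 a,
    stalkMap_comp_germ (Spec.map (CommRingCat.ofHom (algebraMap Γ(Y, U) (R'.sectionsRing U)))) U.2.fromSpec
      ((R'.plusChart U).ι x) (U : Y.Opens) hy2 hy3 a,
    fromSpec_stalkMap_germ U.2, specMap_stalkMap_toStalk]
  rfl

set_option maxHeartbeats 400000 in
/-- **K4-E (I) WITH COMPATIBILITY**: the local ring of `B₊` at `φ_U x` is the local ring `S_q` of the chart algebra (`q` the point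
of `PrimeSpectrum S` under `x`), by a ring isomorphism `Ψ₀` carrying, for every ideal sheaf `K` on `Y`, the stalk of the strict
transform `σˢ(K)|_{B₊}` onto the saturation `⋃ₙ (K(U) S_q : (t⁻¹/1)ⁿ)` (K4-E (I), `exists_stalk_ringEquiv_of_plusChartFac`, same chain
`E₁ ≫ E₂⁻¹ ≫ E₃`) AND the germ of every `a ∈ Γ(Y, U)` at the base point, pushed along `σ₊`, to `a / 1 ∈ S_q`.
[cite: Wlodarczyk2022, 3.3.12] -/
theorem exists_stalk_ringEquiv_of_plusChartFac_compat [IsLocallyNoetherian R'.cobordantBlowup] [IsOpenImmersion φ]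
    (x : (R'.plusChart U : Scheme.{0})) (q : PrimeSpectrum (R'.sectionsRing U)) (hq : (R'.plusChart U).ι x = q)
    (hy : R'.πPlus (φ x) ∈ (U : Y.Opens)) :
    ∃ Ψ₀ : (R'.plus : Scheme.{0}).presheaf.stalk (φ x) ≃+* Localization.AtPrime q.asIdeal,
      (∀ K : Y.IdealSheafData,
        (stalkIdeal (R'.strictTransformPlus K) (φ x)).map
            (Ψ₀ : (R'.plus : Scheme.{0}).presheaf.stalk (φ x) →+* Localization.AtPrime q.asIdeal) =
          ⨆ n : ℕ, (((K.ideal U).map (algebraMap Γ(Y, U) (R'.sectionsRing U))).map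
            (algebraMap (R'.sectionsRing U) (Localization.AtPrime q.asIdeal))).colon
            {algebraMap (R'.sectionsRing U) (Localization.AtPrime q.asIdeal)
              ⟨T (-1), (R'.filtration U).T_neg_one_mem_extendedRees⟩ ^ n}) ∧
      ∀ a : Γ(Y, U), Ψ₀ ((R'.πPlus.stalkMap (φ x)) ((Y.presheaf.germ (U : Y.Opens) (R'.πPlus (φ x)) hy) a)) =
        algebraMap (R'.sectionsRing U) (Localization.AtPrime q.asIdeal) (algebraMap Γ(Y, U) (R'.sectionsRing U) a) := by
  -- the three isomorphisms: along `φ`, along the inclusion of the vertex complement, `𝒪_{Spec S, q} ≅ S_q`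
  let E₁ : (R'.plus : Scheme.{0}).presheaf.stalk (φ x) ≃+* (R'.plusChart U : Scheme.{0}).presheaf.stalk x :=
    (asIso (φ.stalkMap x)).commRingCatIsoToRingEquiv
  have hE20 := exists_stalk_ringEquiv_plusChartι_compat R' U x q hq
  obtain ⟨E₂, hE₂, hE₂s⟩ := hE20
  have hE30 := exists_stalk_ringEquiv_localization_Spec_compat (S := R'.sectionsRing U) q
  obtain ⟨E₃, hE₃, hE₃s⟩ := hE30
  refine ⟨E₁.trans (E₂.symm.trans E₃), fun K => ?_, fun a => ?_⟩
  · -- along `φ` (K4-A)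
    have h1 : (stalkIdeal (R'.strictTransformPlus K) (φ x)).map
        (E₁ : (R'.plus : Scheme.{0}).presheaf.stalk (φ x) →+* (R'.plusChart U : Scheme.{0}).presheaf.stalk x) =
        stalkIdeal ((R'.strictTransformPlus K).comap φ) x :=
      (stalkIdeal_comap_eq_map_ringEquiv φ (R'.strictTransformPlus K) x).symm
    -- along the inclusion of the vertex complement (K4-A backwards), through the chart computation
    have h2 := (congrArg (fun Z : (R'.plusChart U : Scheme.{0}).IdealSheafData => (stalkIdeal Z x).map
        (E₂.symm : (R'.plusChart U : Scheme.{0}).presheaf.stalk x →+*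
          (Spec (CommRingCat.of (R'.sectionsRing U))).presheaf.stalk q))
        (comap_strictTransformPlus_of_plusChartFac R' U φ hφ K)).trans (hE₂ _)
    -- on `Spec S` (K4-B) into `S_q`, then the saturation bookkeeping in `S_q`
    have h3 := hE₃ (⨆ n : ℕ, ((K.ideal U).map (algebraMap Γ(Y, U) (R'.sectionsRing U))).colon
        ((Ideal.span {(⟨T (-1), (R'.filtration U).T_neg_one_mem_extendedRees⟩ : R'.sectionsRing U)} ^ n :
          Ideal (R'.sectionsRing U)) : Set (R'.sectionsRing U)))
    have h4 := (congrArg (Ideal.map (algebraMap (R'.sectionsRing U) (Localization.AtPrime q.asIdeal)))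
        (iSup_colon_span_pow_eq_iSup_colon_singleton_pow ((K.ideal U).map (algebraMap Γ(Y, U) (R'.sectionsRing U)))
          (⟨T (-1), (R'.filtration U).T_neg_one_mem_extendedRees⟩ : R'.sectionsRing U))).trans
      (map_iSup_colon_singleton_pow q.asIdeal (Localization.AtPrime q.asIdeal)
        ((K.ideal U).map (algebraMap Γ(Y, U) (R'.sectionsRing U)))
        (⟨T (-1), (R'.filtration U).T_neg_one_mem_extendedRees⟩ : R'.sectionsRing U))
    exact ideal_map_ringEquiv_trans₃ E₁ E₂ E₃ h1 h2 (h3.trans h4)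
  · -- compatibility: along `φ` and `σ₊` the germ becomes `ι^♯ (toStalk S (ι x) (a·1))`, which `E₂⁻¹` reads at `q` and `E₃` as `a/1`
    have hstep := stalkMap_plusChartFac_stalkMap_πPlus_germ R' U φ hφ x hy a
    have hE₁ : E₁ ((R'.πPlus.stalkMap (φ x)) ((Y.presheaf.germ (U : Y.Opens) (R'.πPlus (φ x)) hy) a)) =
        E₂ (StructureSheaf.toStalk (R'.sectionsRing U) q (algebraMap Γ(Y, U) (R'.sectionsRing U) a)) := by
      rw [hE₂s]
      exact hstep
    change E₃ (E₂.symm (E₁ _)) = _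
    rw [hE₁, E₂.symm_apply_apply, hE₃s]

end Chart

/-! ## The game-side model with compatibility -/

section GameSideChart

variable {Y : Scheme.{0}} (R' : ReesFiltration Y) (U : Y.affineOpens)
  (φ : (R'.plusChart U : Scheme.{0}) ⟶ (R'.plus : Scheme.{0}))
  (hφ : φ ≫ R'.plus.ι = (R'.plusChart U).ι ≫ R'.openCover.f ⟨U.1, U.2⟩)

include hφ

/-- **K4-E, GAME-SIDE FORM WITH COMPATIBILITY (chart version).**  As `exists_gameSide_stalk_model_of_plusChartFac` — a prime `𝔫'` of
`extReesAlgebra I'` (`I'ₙ = 𝒥ₙ(U) A'`, `A'` a localisation of `A = Γ(Y, U)` at `𝔮 = q ∩ A`) and `Ψ : 𝒪_{B₊, φ_U x} ≃+* (extReesAlgebra I')_{𝔫'}`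
transporting strict transforms to `t⁻¹`-saturations, `𝔫'` off the vertex, over `𝔮 A'`, containing `t⁻¹` iff `q` does — PLUS:
`Ψ (σ₊^♯ (a_y)) = a / 1` for every `a ∈ Γ(Y, U)` (`Ψ = Ψ₀ ≫ g`, `Ψ₀` compatible by `exists_stalk_ringEquiv_of_plusChartFac_compat`, `g` by
res-type-048's `hgbase`). [cite: Wlodarczyk2022, Def. 5.1.1; 3.3.12] -/
theorem exists_gameSide_stalk_model_of_plusChartFac_compat [IsLocallyNoetherian R'.cobordantBlowup] [IsOpenImmersion φ]
    (x : (R'.plusChart U : Scheme.{0})) (q : PrimeSpectrum (R'.sectionsRing U)) (hq : (R'.plusChart U).ι x = q)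
    (hy : R'.πPlus (φ x) ∈ (U : Y.Opens))
    (𝔮 : Ideal Γ(Y, U)) [𝔮.IsPrime] (h𝔮 : q.asIdeal.comap (algebraMap Γ(Y, U) (R'.sectionsRing U)) = 𝔮)
    {A' : Type} [CommRing A'] [IsLocalRing A'] [Algebra Γ(Y, U) A'] [IsLocalization.AtPrime A' 𝔮]
    {I' : ℕ → Ideal A'} (hI' : ∀ n, I' n = ((R'.ideal n).ideal U).map (algebraMap Γ(Y, U) A')) :
    ∃ (𝔫' : Ideal (extReesAlgebra I')) (_ : 𝔫'.IsPrime)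
      (Ψ : (R'.plus : Scheme.{0}).presheaf.stalk (φ x) ≃+* Localization.AtPrime 𝔫'),
      (∀ K : Y.IdealSheafData,
        (stalkIdeal (R'.strictTransformPlus K) (φ x)).map
            (Ψ : (R'.plus : Scheme.{0}).presheaf.stalk (φ x) →+* Localization.AtPrime 𝔫') =
          ⨆ n : ℕ, ((((K.ideal U).map (algebraMap Γ(Y, U) A')).map (algebraMap A' (extReesAlgebra I'))).map
            (algebraMap (extReesAlgebra I') (Localization.AtPrime 𝔫'))).colon
            {algebraMap (extReesAlgebra I') (Localization.AtPrime 𝔫') (extReesAlgebra.tInv I') ^ n}) ∧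
      ¬ extReesAlgebra.vertexIdeal I' ≤ 𝔫' ∧
      (maximalIdeal A').map (algebraMap A' (extReesAlgebra I')) ≤ 𝔫' ∧
      (extReesAlgebra.tInv I' ∈ 𝔫' ↔
        (⟨T (-1), (R'.filtration U).T_neg_one_mem_extendedRees⟩ : R'.sectionsRing U) ∈ q.asIdeal) ∧
      ∀ a : Γ(Y, U), Ψ ((R'.πPlus.stalkMap (φ x)) ((Y.presheaf.germ (U : Y.Opens) (R'.πPlus (φ x)) hy) a)) =
        algebraMap (extReesAlgebra I') (Localization.AtPrime 𝔫')
          (algebraMap A' (extReesAlgebra I') (algebraMap Γ(Y, U) A' a)) := by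
  have hK4 := exists_stalk_ringEquiv_of_plusChartFac_compat R' U φ hφ x q hq hy
  obtain ⟨Ψ₀, hΨ₀, hΨ₀s⟩ := hK4
  -- res-type-048's package at the prime `q` of `S = ⊕ 𝒥ₙ(U) tⁿ`, which misses `A ∖ 𝔮`
  have hd : Disjoint ((𝔮.primeCompl.map (algebraMap Γ(Y, U) (R'.sectionsRing U)) :
      Submonoid (R'.sectionsRing U)) : Set (R'.sectionsRing U)) (q.asIdeal : Set (R'.sectionsRing U)) := by
    rw [Set.disjoint_left]
    rintro s ⟨a, ha, rfl⟩ hs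
    exact ha (show a ∈ 𝔮 by rw [← h𝔮]; exact hs)
  have hpk := exists_prime_extReesAlgebra_ringEquiv_localization_T_sectionsRing R' U 𝔮.primeCompl hI' q.asIdeal hd
  obtain ⟨𝔫', h𝔫', g, hgbase, hgT, hgvert, hgprime, hgtInv⟩ := hpk
  -- the structure maps `A → (extReesAlgebra I')_{𝔫'}` through `S_q` and through `A'` agree
  have hcomp : ((g : Localization.AtPrime q.asIdeal →+* Localization.AtPrime 𝔫').comp
      (algebraMap (R'.sectionsRing U) (Localization.AtPrime q.asIdeal))).comp
        (algebraMap Γ(Y, U) (R'.sectionsRing U)) =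
      ((algebraMap (extReesAlgebra I') (Localization.AtPrime 𝔫')).comp
        (algebraMap A' (extReesAlgebra I'))).comp (algebraMap Γ(Y, U) A') :=
    RingHom.ext fun a => hgbase a
  have hJ : ∀ K : Y.IdealSheafData, (((K.ideal U).map (algebraMap Γ(Y, U) (R'.sectionsRing U))).map
      (algebraMap (R'.sectionsRing U) (Localization.AtPrime q.asIdeal))).map
      (g : Localization.AtPrime q.asIdeal →+* Localization.AtPrime 𝔫') =
      (((K.ideal U).map (algebraMap Γ(Y, U) A')).map (algebraMap A' (extReesAlgebra I'))).map
        (algebraMap (extReesAlgebra I') (Localization.AtPrime 𝔫')) := fun K => by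
    rw [Ideal.map_map, Ideal.map_map, hcomp, ← Ideal.map_map, ← Ideal.map_map]
  -- (I) on the game side, stated verbatim as in the conclusion (syntactic final assembly)
  have hA := fun K : Y.IdealSheafData =>
    @map_iSup_colon_singleton_pow_of_ringEquiv (Localization.AtPrime q.asIdeal) _ (Localization.AtPrime 𝔫') _ g
      _ _ (hJ K) _ _ hgtInv
  have hB : ∀ K : Y.IdealSheafData, (stalkIdeal (R'.strictTransformPlus K) (φ x)).map
      ((Ψ₀.trans g : (R'.plus : Scheme.{0}).presheaf.stalk (φ x) ≃+* Localization.AtPrime 𝔫') :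
        (R'.plus : Scheme.{0}).presheaf.stalk (φ x) →+* Localization.AtPrime 𝔫') =
      ⨆ n : ℕ, ((((K.ideal U).map (algebraMap Γ(Y, U) A')).map (algebraMap A' (extReesAlgebra I'))).map
        (algebraMap (extReesAlgebra I') (Localization.AtPrime 𝔫'))).colon
        {algebraMap (extReesAlgebra I') (Localization.AtPrime 𝔫') (extReesAlgebra.tInv I') ^ n} := fun K =>
    (Ideal.map_map (Ψ₀ : (R'.plus : Scheme.{0}).presheaf.stalk (φ x) →+* Localization.AtPrime q.asIdeal)
      (g : Localization.AtPrime q.asIdeal →+* Localization.AtPrime 𝔫')).symm.trans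
      ((congrArg (Ideal.map (g : Localization.AtPrime q.asIdeal →+* Localization.AtPrime 𝔫')) (hΨ₀ K)).trans (hA K))
  have hV : ¬ extReesAlgebra.vertexIdeal I' ≤ 𝔫' := by
    rw [hgvert]
    exact not_irrelevant_le_of_plusChart R' U x q hq
  have hM : (maximalIdeal A').map (algebraMap A' (extReesAlgebra I')) ≤ 𝔫' := by
    rw [← IsLocalization.AtPrime.map_eq_maximalIdeal 𝔮 A', hgprime 𝔮, Ideal.map_le_iff_le_comap, h𝔮]
  have hC : ∀ a : Γ(Y, U), (Ψ₀.trans g) ((R'.πPlus.stalkMap (φ x))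
      ((Y.presheaf.germ (U : Y.Opens) (R'.πPlus (φ x)) hy) a)) =
      algebraMap (extReesAlgebra I') (Localization.AtPrime 𝔫')
        (algebraMap A' (extReesAlgebra I') (algebraMap Γ(Y, U) A' a)) := fun a => by
    rw [RingEquiv.trans_apply, hΨ₀s a]
    exact hgbase a
  exact ⟨𝔫', h𝔫', Ψ₀.trans g, hB, hV, hM, hgT, hC⟩

end GameSideChart

/-! ## Chart-free form at a point of `B₊` over an affine open -/

section Pointwise

variable {Y : Scheme.{0}} (R' : ReesFiltration Y) (U : Y.affineOpens)

/-- **K4-E, GAME-SIDE FORM (point version) WITH STALK-MAP COMPATIBILITY** — `exists_gameSide_stalk_model` (K4-E) VERBATIM plus ONE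
conjunct: the model isomorphism `Ψ : 𝒪_{B₊, y'} ≃+* (extReesAlgebra I')_{𝔫'}` (`A' = A_{𝔮_y}` the dictionary model of `𝒪_{Y,y}`,
`y = σ₊ y' ∈ U = Spec A`, `I'ₙ = 𝒥ₙ(U) A'`) satisfies `Ψ (σ₊^♯_{y'} (a_y)) = a / 1` for every section `a ∈ Γ(Y, U)`.
[cite: Wlodarczyk2022, Def. 5.1.1; 3.3.12] -/
theorem exists_gameSide_stalk_model_compat [IsLocallyNoetherian R'.cobordantBlowup]
    (y' : (R'.plus : Scheme.{0})) (hy : R'.πPlus y' ∈ (U : Y.Opens))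
    {I' : ℕ → Ideal (Localization.AtPrime (U.2.primeIdealOf ⟨R'.πPlus y', hy⟩).asIdeal)}
    (hI' : ∀ n, I' n = ((R'.ideal n).ideal U).map
      (algebraMap Γ(Y, U) (Localization.AtPrime (U.2.primeIdealOf ⟨R'.πPlus y', hy⟩).asIdeal))) :
    ∃ (𝔫' : Ideal (extReesAlgebra I')) (_ : 𝔫'.IsPrime)
      (Ψ : (R'.plus : Scheme.{0}).presheaf.stalk y' ≃+* Localization.AtPrime 𝔫'),
      (∀ K : Y.IdealSheafData,
        (stalkIdeal (R'.strictTransformPlus K) y').map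
            (Ψ : (R'.plus : Scheme.{0}).presheaf.stalk y' →+* Localization.AtPrime 𝔫') =
          ⨆ n : ℕ, ((((K.ideal U).map (algebraMap Γ(Y, U)
              (Localization.AtPrime (U.2.primeIdealOf ⟨R'.πPlus y', hy⟩).asIdeal))).map
              (algebraMap _ (extReesAlgebra I'))).map (algebraMap (extReesAlgebra I') (Localization.AtPrime 𝔫'))).colon
            {algebraMap (extReesAlgebra I') (Localization.AtPrime 𝔫') (extReesAlgebra.tInv I') ^ n}) ∧
      ¬ extReesAlgebra.vertexIdeal I' ≤ 𝔫' ∧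
      (maximalIdeal (Localization.AtPrime (U.2.primeIdealOf ⟨R'.πPlus y', hy⟩).asIdeal)).map
        (algebraMap _ (extReesAlgebra I')) ≤ 𝔫' ∧
      (∀ a : Γ(Y, U),
        Ψ ((R'.πPlus.stalkMap y').hom ((Y.presheaf.germ (U : Y.Opens) (R'.πPlus y') hy).hom a)) =
          algebraMap (extReesAlgebra I') (Localization.AtPrime 𝔫')
            (algebraMap _ (extReesAlgebra I')
              (algebraMap Γ(Y, U) (Localization.AtPrime (U.2.primeIdealOf ⟨R'.πPlus y', hy⟩).asIdeal) a))) := by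
  -- (`obtain` directly on these existentials is prohibitively slow to elaborate here; go through `have`)
  have hφ0 := exists_plusChartFac R' U
  obtain ⟨φ, hφo, hφ⟩ := hφ0
  have hx0 := exists_plusChartFac_apply_eq R' U φ hφ y' hy
  obtain ⟨x, rfl⟩ := hx0
  have hq0 : ∃ q : PrimeSpectrum (R'.sectionsRing U), (R'.plusChart U).ι x = q := ⟨_, rfl⟩
  obtain ⟨q, hq⟩ := hq0
  haveI : q.asIdeal.IsPrime := q.isPrime
  have h𝔮 := (primeIdealOf_πPlus_plusChartFac_asIdeal R' U φ hφ x q hq).symm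
  have hm := exists_gameSide_stalk_model_of_plusChartFac_compat R' U φ hφ x q hq hy _ h𝔮 hI'
  obtain ⟨𝔫', h𝔫', Ψ, hΨ, hvert, hbase, -, hcompat⟩ := hm
  exact ⟨𝔫', h𝔫', Ψ, hΨ, hvert, hbase, hcompat⟩

/-- **The registrar's SPEC (Δ8) `GameSideStalkModelCompat`, binder for binder** (stated here as a theorem with the SPEC's body; the
named `Prop` of `HOME/L/res-L1-w43-plan-1/Compat_sketch.lean` is closed by `fun R' U _ y' hy _ hI' => …` of this).
[cite: Wlodarczyk2022, Def. 5.1.1; 3.3.12] -/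
theorem gameSideStalkModelCompat :
    ∀ {Y : Scheme.{0}} (R' : ReesFiltration Y) (U : Y.affineOpens) [IsLocallyNoetherian R'.cobordantBlowup]
    (y' : (R'.plus : Scheme.{0})) (hy : R'.πPlus y' ∈ (U : Y.Opens))
    {I' : ℕ → Ideal (Localization.AtPrime (U.2.primeIdealOf ⟨R'.πPlus y', hy⟩).asIdeal)}
    (_ : ∀ n, I' n = ((R'.ideal n).ideal U).map
      (algebraMap Γ(Y, U) (Localization.AtPrime (U.2.primeIdealOf ⟨R'.πPlus y', hy⟩).asIdeal))),
    ∃ (𝔫' : Ideal (extReesAlgebra I')) (_ : 𝔫'.IsPrime)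
      (Ψ : (R'.plus : Scheme.{0}).presheaf.stalk y' ≃+* Localization.AtPrime 𝔫'),
      (∀ K : Y.IdealSheafData,
        (stalkIdeal (R'.strictTransformPlus K) y').map
            (Ψ : (R'.plus : Scheme.{0}).presheaf.stalk y' →+* Localization.AtPrime 𝔫') =
          ⨆ n : ℕ, ((((K.ideal U).map (algebraMap Γ(Y, U)
              (Localization.AtPrime (U.2.primeIdealOf ⟨R'.πPlus y', hy⟩).asIdeal))).map
              (algebraMap _ (extReesAlgebra I'))).map (algebraMap (extReesAlgebra I') (Localization.AtPrime 𝔫'))).colon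
            {algebraMap (extReesAlgebra I') (Localization.AtPrime 𝔫') (extReesAlgebra.tInv I') ^ n}) ∧
      ¬ extReesAlgebra.vertexIdeal I' ≤ 𝔫' ∧
      (maximalIdeal (Localization.AtPrime (U.2.primeIdealOf ⟨R'.πPlus y', hy⟩).asIdeal)).map
        (algebraMap _ (extReesAlgebra I')) ≤ 𝔫' ∧
      (∀ a : Γ(Y, U),
        Ψ ((R'.πPlus.stalkMap y').hom ((Y.presheaf.germ (U : Y.Opens) (R'.πPlus y') hy).hom a)) =
          algebraMap (extReesAlgebra I') (Localization.AtPrime 𝔫')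
            (algebraMap _ (extReesAlgebra I')
              (algebraMap Γ(Y, U) (Localization.AtPrime (U.2.primeIdealOf ⟨R'.πPlus y', hy⟩).asIdeal) a))) :=
  fun R' U _ y' hy _ hI' => exists_gameSide_stalk_model_compat R' U y' hy hI'

end Pointwise

end Summit.ResolutionOfSingularities.ResolutionOfSingularities.Cruxes.HypersurfaceCentreConstruction.LocalEngine

end
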